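import Summits.QuantumFields.YangMills.Theorems.VirialFluxGapConjugationKernelFix
import Summits.QuantumFields.YangMills.Theorems.VirialFluxGapCentralFieldSmooth
import Literature.Geometry.GaugeTheory.SpinorAlgebraFour
import Literature.MathematicalPhysics.QuantumFieldTheory.Balaban1983to89.T4QuatExpLog
import HarnessLib

/-!
# Route `VirialFluxGap` (YangMills): the conjugation kernel vectors at an AXIAL comb ring — quaternion letters and DOT PRODUCTS
# (part A of the six-vector package, upgrade (U3) `½(#ι − 4) → ½(#ι − 6) = 9L⁴ − 3/2`; sequel of ✓`VirialFluxGapConjugationKernelFix`; §7 is part B)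

LEAD ym-line-sfw-p2 g97 (cell ym-idea-1, free hands; `--supports stmt-QuantumFields-24196`).  ✓`VirialFluxGapConjugationKernelFix` proved that the
global-conjugation directions `conjDir h p` are exact kernel vectors at any zero.  Here, at a comb ring `((fun _ => combFlat h'), fun _ => c')`
with data on an axis `n ≠ 0` and at least one NON-CENTRAL datum, the two conjugation vectors for `h = quatMatrix m`, `quatMatrix m'`
(`m, m' ⊥ n`, `m ⊥ m'`) are orthogonal to the four sheet vectors of ✓`exists_four_orthonormal_kernel_vectors`, to each other, and non-zero:

* §5 quaternion letters: `conjDir (quatMatrix m) p w = quatMatrix(q̄ m q − m)` (`q = su2Quat` of the variable; ✓`quatMatrix_star`, ✓`quatMatrix_sub`,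
  ✓`CentralField.pauliCoord_quatMatrix` reused), and the two POLYNOMIAL identities for the Pauli pairings at an AXIAL variable (`Im q = t·n`):
  `Σ_a pc_a(q̄mq − m)pc_a(q̄m′q − m′) = 4[(S² + 4r²t²N)(m·m′) + (4t²S + 4t⁴N − 4r²t²)(m·n)(m′·n)]`, `Σ_a pc_a(q̄mq − m)pc_a(⟨0,n⟩) = 4(r² + t²N − 1)(m·n)`;
* §6 at the comb ring every variable is axial (`comb_varMat_axial`), hence: conj ⊥ wrap sheets, conj ⊥ seam sheet, conj(m) ⊥ conj(m′), and
  `|conj(m)|² ≥ 16t²N|m|² > 0` at a non-central wrap block (`th k ≠ 0`) or seam (`tc ≠ 0`) (`normSq = 1`);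
* §7 `exists_perp_pair` (two orthogonal vectors `⊥ n`), `exists_orthonormal_six`, and ★★★ `exists_six_orthonormal_kernel_vectors` — the `m = 6` input
  `hon ∕ hker` of ✓`generic_divergence_upper`: with it (E2) of ✓`fix_generic_divergence_upper` reads `½(#ι − 6) + …`, i.e. the generic Euler field has
  divergence `18L⁴ − 3 + o(1)`, matching the sharp central budget ✓`centralDiv_le_budget`; fed to ✓`gibbsMeanWindow_of_eulerFieldFixFamily` this is
  the road to ⟨24196⟩ `ToronSoftnessSharp` (✓`toronSoftnessSharp_of_eulerFieldFixFamily`).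
HONEST LABEL: linear-algebra ∕ quaternion bookkeeping; the rerun of the ⟨24141⟩ assembly with `m = 6` and `δ`-dependent parameters is NOT here; ⟨24196⟩ ∕
⟨24194⟩ ∕ ⟨24197⟩ OPEN; own crux ⟨22884⟩ OPEN (blocked-on ⟨19935⟩); the Yang–Mills mass gap is NOT proved; no summit is proved by a line.  THEOREMS ONLY
(0 `def`, 0 `sorry`), standard axioms.  References: [cite: Luscher1983, §2] (toron valley); [folklore].
-/

set_option autoImplicit false

noncomputable section

open scoped Matrix BigOperators ContDiff Topology Quaternion Matrix.Norms.Frobenius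
open MeasureTheory Set Matrix
open Literature.MathematicalPhysics.QuantumFieldTheory hiding SU2
open Literature.MathematicalPhysics.QuantumLattice
open Literature.MathematicalPhysics.QuantumFieldTheory.SUNBakryEmery (expSU coe_expSU matTop)

namespace Summit.QuantumFields.YangMills.Theorems.VirialFluxGap.FixFrame

open Summit.QuantumFields.YangMills.Theorems.FemtoTransferGap
open Summit.QuantumFields.YangMills.Theorems.FemtoTransferGap.TT
open Summit.QuantumFields.YangMills.Theorems.FemtoTransferGap.TwoLattice
open Summit.QuantumFields.YangMills.Theorems.FemtoTransferGap.TwoLattice.Flat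
open Summit.QuantumFields.YangMills.Theorems.VirialFluxGap.RingDeficit
open Summit.QuantumFields.YangMills.Theorems.VirialFluxGap.FrameDerivative
open Summit.QuantumFields.YangMills.Theorems.VirialFluxGap.FrameHessian
open Summit.QuantumFields.YangMills.Theorems.VirialFluxGap.RegularValley

variable {L : ℕ} [NeZero L]

attribute [local instance 2000] Literature.MathematicalPhysics.QuantumFieldTheory.SUNBakryEmery.matTop

/-! ## §5 Quaternion letters: the conjugation slot at an axial variable -/

omit [NeZero L] in
/-- ★ The conjugation slot at a variable with quaternion `q`, for `h = quatMatrix m`: `P⁻¹·h·P − h = quatMatrix(q̄·m·q − m)`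
(`P = quatMatrix q`, `q = su2Quat P`). [folklore] -/
theorem conjDir_quat (m : ℍ) (p : (Fin (2 * L - 1 + 1) → GaugeConfig 3 L SU2) × (Site 3 L → SU2))
    (w : (Fin (2 * L - 1 + 1) × Edge 3 L) ⊕ Site 3 L) :
    conjDir (quatMatrix m) p w = quatMatrix (star (su2Quat (varMat p w)) * m * su2Quat (varMat p w) - m) := by
  unfold conjDir conjA constDir
  rw [← quatMatrix_su2Quat (varMat p w), ← Literature.Geometry.GaugeTheory.quatMatrix_star, ← quatMatrix_mul, ← quatMatrix_mul,
    ← Literature.MathematicalPhysics.QuantumFieldTheory.Balaban1983to89.T4QuatExpLog.quatMatrix_sub]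

omit [NeZero L] in
/-- ★ **The pointwise Pauli pairing of two conjugation slots at an AXIAL variable.**  For a quaternion `q` with imaginary part `t·n` and pure
imaginary `m, m'`: `Σ_a pc_a(q̄ m q − m)·pc_a(q̄ m′ q − m′) = 4·[(S² + 4r²t²N)(m·m′) + (4t²S + 4t⁴N − 4r²t²)(m·n)(m′·n)]`,
`r = re q`, `N = |n|²`, `S = r² − t²N − 1` — an identity of polynomials. [folklore] -/
theorem sum_pauliCoord_conj_mul_conj {q : ℍ} {t n₁ n₂ n₃ : ℝ} (hq : q.imI = t * n₁ ∧ q.imJ = t * n₂ ∧ q.imK = t * n₃)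
    {m m' : ℍ} (hm : m.re = 0) (hm' : m'.re = 0) :
    ∑ a : Fin 3, pauliCoord (quatMatrix (star q * m * q - m)) a * pauliCoord (quatMatrix (star q * m' * q - m')) a =
      4 * (((q.re ^ 2 - t ^ 2 * (n₁ ^ 2 + n₂ ^ 2 + n₃ ^ 2) - 1) ^ 2 + 4 * q.re ^ 2 * t ^ 2 * (n₁ ^ 2 + n₂ ^ 2 + n₃ ^ 2)) *
          (m.imI * m'.imI + m.imJ * m'.imJ + m.imK * m'.imK) +
        (4 * t ^ 2 * (q.re ^ 2 - t ^ 2 * (n₁ ^ 2 + n₂ ^ 2 + n₃ ^ 2) - 1) + 4 * t ^ 4 * (n₁ ^ 2 + n₂ ^ 2 + n₃ ^ 2) - 4 * q.re ^ 2 * t ^ 2) *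
          ((m.imI * n₁ + m.imJ * n₂ + m.imK * n₃) * (m'.imI * n₁ + m'.imJ * n₂ + m'.imK * n₃))) := by
  obtain ⟨hI, hJ, hK⟩ := hq
  obtain ⟨e0, e1, e2⟩ := CentralField.pauliCoord_quatMatrix (star q * m * q - m)
  obtain ⟨f0, f1, f2⟩ := CentralField.pauliCoord_quatMatrix (star q * m' * q - m')
  rw [Fin.sum_univ_three, e0, e1, e2, f0, f1, f2]
  simp only [Quaternion.imI_sub, Quaternion.imJ_sub, Quaternion.imK_sub, Quaternion.imI_mul, Quaternion.imJ_mul, Quaternion.imK_mul,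
    Quaternion.re_mul, Quaternion.re_star, Quaternion.imI_star, Quaternion.imJ_star, Quaternion.imK_star, hI, hJ, hK, hm, hm']
  ring

omit [NeZero L] in
/-- ★ **The pointwise Pauli pairing of a conjugation slot with the AXIS direction** `quatMatrix⟨0,n⟩` (`o` a quaternion with `re o = 0`,
`Im o = n`): `Σ_a pc_a(q̄ m q − m)·pc_a(o) = 4·(r² + t²N − 1)·(m·n)`. [folklore] -/
theorem sum_pauliCoord_conj_mul_axis {q : ℍ} {t n₁ n₂ n₃ : ℝ} (hq : q.imI = t * n₁ ∧ q.imJ = t * n₂ ∧ q.imK = t * n₃)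
    {m o : ℍ} (hm : m.re = 0) (ho : o.imI = n₁ ∧ o.imJ = n₂ ∧ o.imK = n₃) :
    ∑ a : Fin 3, pauliCoord (quatMatrix (star q * m * q - m)) a * pauliCoord (quatMatrix o) a =
      4 * (q.re ^ 2 + t ^ 2 * (n₁ ^ 2 + n₂ ^ 2 + n₃ ^ 2) - 1) * (m.imI * n₁ + m.imJ * n₂ + m.imK * n₃) := by
  obtain ⟨hI, hJ, hK⟩ := hq
  obtain ⟨ho1, ho2, ho3⟩ := ho
  obtain ⟨e0, e1, e2⟩ := CentralField.pauliCoord_quatMatrix (star q * m * q - m)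
  obtain ⟨f0, f1, f2⟩ := CentralField.pauliCoord_quatMatrix o
  rw [Fin.sum_univ_three, e0, e1, e2, f0, f1, f2]
  simp only [Quaternion.imI_sub, Quaternion.imJ_sub, Quaternion.imK_sub, Quaternion.imI_mul, Quaternion.imJ_mul, Quaternion.imK_mul,
    Quaternion.re_mul, Quaternion.re_star, Quaternion.imI_star, Quaternion.imJ_star, Quaternion.imK_star, hI, hJ, hK, hm, ho1, ho2, ho3]
  ring

/-! ## §6 Dot products at an axial comb ring -/

omit [NeZero L] in
/-- The identity of `SU(2)` has zero imaginary quaternion part. [folklore] -/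
theorem su2Quat_one_im : (su2Quat (1 : SU2)).imI = 0 ∧ (su2Quat (1 : SU2)).imJ = 0 ∧ (su2Quat (1 : SU2)).imK = 0 := by
  refine ⟨?_, ?_, ?_⟩ <;> simp [su2Quat]

omit [NeZero L] in
/-- ★ At the comb ring `((fun _ => combFlat h'), fun _ => c')` with data on the axis `n`, EVERY ring variable is axial:
its quaternion has imaginary part `t·n` for some `t`. [folklore] -/
theorem comb_varMat_axial (n₁ n₂ n₃ : ℝ) {h' : Fin 3 → SU2} {c' : SU2} {th : Fin 3 → ℝ} {tc : ℝ}
    (hh' : ∀ j, (su2Quat (h' j)).imI = th j * n₁ ∧ (su2Quat (h' j)).imJ = th j * n₂ ∧ (su2Quat (h' j)).imK = th j * n₃)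
    (hc' : (su2Quat c').imI = tc * n₁ ∧ (su2Quat c').imJ = tc * n₂ ∧ (su2Quat c').imK = tc * n₃)
    (w : (Fin (2 * L - 1 + 1) × Edge 3 L) ⊕ Site 3 L) :
    ∃ t : ℝ, (su2Quat (varMat (((fun _ => combFlat h'), fun _ => c') :
        (Fin (2 * L - 1 + 1) → GaugeConfig 3 L SU2) × (Site 3 L → SU2)) w)).imI = t * n₁ ∧
      (su2Quat (varMat (((fun _ => combFlat h'), fun _ => c') :
        (Fin (2 * L - 1 + 1) → GaugeConfig 3 L SU2) × (Site 3 L → SU2)) w)).imJ = t * n₂ ∧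
      (su2Quat (varMat (((fun _ => combFlat h'), fun _ => c') :
        (Fin (2 * L - 1 + 1) → GaugeConfig 3 L SU2) × (Site 3 L → SU2)) w)).imK = t * n₃ := by
  rcases w with ⟨i, e⟩ | x
  · simp only [varMat, Sum.elim_inl, combFlat_apply]
    by_cases he : e.1 e.2 = -1
    · rw [if_pos he]; exact ⟨th e.2, hh' e.2⟩
    · rw [if_neg he]
      obtain ⟨h1, h2, h3⟩ := su2Quat_one_im
      exact ⟨0, by rw [h1, zero_mul], by rw [h2, zero_mul], by rw [h3, zero_mul]⟩
  · simp only [varMat, Sum.elim_inr]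
    exact ⟨tc, hc'⟩

/-- ★ **A conjugation vector is orthogonal to every wrap sheet vector** (pointwise: the conjugation slot is `⊥ n`, the sheet slot is `∥ n`),
for `m` pure imaginary with `m ⊥ n`. [folklore] -/
theorem fixCoord_conj_dot_wrap (n₁ n₂ n₃ : ℝ) {h' : Fin 3 → SU2} {c' : SU2} {th : Fin 3 → ℝ} {tc : ℝ}
    (hh' : ∀ j, (su2Quat (h' j)).imI = th j * n₁ ∧ (su2Quat (h' j)).imJ = th j * n₂ ∧ (su2Quat (h' j)).imK = th j * n₃)
    (hc' : (su2Quat c').imI = tc * n₁ ∧ (su2Quat c').imJ = tc * n₂ ∧ (su2Quat c').imK = tc * n₃)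
    {m : ℍ} (hm : m.re = 0) (hmn : m.imI * n₁ + m.imJ * n₂ + m.imK * n₃ = 0) (k : Fin 3) :
    fixCoord (conjDir (quatMatrix m) (((fun _ => combFlat h'), fun _ => c') :
        (Fin (2 * L - 1 + 1) → GaugeConfig 3 L SU2) × (Site 3 L → SU2))) ⬝ᵥ
      fixCoord (wrapBlockDir (L := L) k (quatMatrix (⟨0, n₁, n₂, n₃⟩ : ℍ))) = 0 := by
  rw [dotProduct, Fintype.sum_prod_type]
  refine Finset.sum_eq_zero fun v _ => ?_
  by_cases hB : isWrapB (L := L) k (fixVar v) = true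
  · obtain ⟨t, ht⟩ := comb_varMat_axial (L := L) n₁ n₂ n₃ hh' hc' (fixVar v)
    have h := sum_pauliCoord_conj_mul_axis ht hm (o := (⟨0, n₁, n₂, n₃⟩ : ℍ)) ⟨rfl, rfl, rfl⟩
    rw [hmn, mul_zero] at h
    refine Eq.trans (Finset.sum_congr rfl fun a _ => ?_) h
    rw [fixCoord_apply, fixCoord_wrapBlockDir_apply, if_pos hB, conjDir_quat]
  · refine Finset.sum_eq_zero fun a _ => ?_
    rw [fixCoord_wrapBlockDir_apply, if_neg hB, mul_zero]

/-- ★ **A conjugation vector is orthogonal to the seam sheet vector**, for `m` pure imaginary with `m ⊥ n`. [folklore] -/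
theorem fixCoord_conj_dot_seam (n₁ n₂ n₃ : ℝ) {h' : Fin 3 → SU2} {c' : SU2} {th : Fin 3 → ℝ} {tc : ℝ}
    (hh' : ∀ j, (su2Quat (h' j)).imI = th j * n₁ ∧ (su2Quat (h' j)).imJ = th j * n₂ ∧ (su2Quat (h' j)).imK = th j * n₃)
    (hc' : (su2Quat c').imI = tc * n₁ ∧ (su2Quat c').imJ = tc * n₂ ∧ (su2Quat c').imK = tc * n₃)
    {m : ℍ} (hm : m.re = 0) (hmn : m.imI * n₁ + m.imJ * n₂ + m.imK * n₃ = 0) :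
    fixCoord (conjDir (quatMatrix m) (((fun _ => combFlat h'), fun _ => c') :
        (Fin (2 * L - 1 + 1) → GaugeConfig 3 L SU2) × (Site 3 L → SU2))) ⬝ᵥ
      fixCoord (seamBlockDir (L := L) (quatMatrix (⟨0, n₁, n₂, n₃⟩ : ℍ))) = 0 := by
  rw [dotProduct, Fintype.sum_prod_type]
  refine Finset.sum_eq_zero fun v _ => ?_
  by_cases hB : isSeamB (L := L) (fixVar v) = true
  · obtain ⟨t, ht⟩ := comb_varMat_axial (L := L) n₁ n₂ n₃ hh' hc' (fixVar v)
    have h := sum_pauliCoord_conj_mul_axis ht hm (o := (⟨0, n₁, n₂, n₃⟩ : ℍ)) ⟨rfl, rfl, rfl⟩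
    rw [hmn, mul_zero] at h
    refine Eq.trans (Finset.sum_congr rfl fun a _ => ?_) h
    rw [fixCoord_apply, fixCoord_seamBlockDir_apply, if_pos hB, conjDir_quat]
  · refine Finset.sum_eq_zero fun a _ => ?_
    rw [fixCoord_seamBlockDir_apply, if_neg hB, mul_zero]

/-- ★ **Two conjugation vectors with orthogonal generators `m ⊥ m′` (both `⊥ n`) are orthogonal.** [folklore] -/
theorem fixCoord_conj_dot_conj (n₁ n₂ n₃ : ℝ) {h' : Fin 3 → SU2} {c' : SU2} {th : Fin 3 → ℝ} {tc : ℝ}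
    (hh' : ∀ j, (su2Quat (h' j)).imI = th j * n₁ ∧ (su2Quat (h' j)).imJ = th j * n₂ ∧ (su2Quat (h' j)).imK = th j * n₃)
    (hc' : (su2Quat c').imI = tc * n₁ ∧ (su2Quat c').imJ = tc * n₂ ∧ (su2Quat c').imK = tc * n₃)
    {m m' : ℍ} (hm : m.re = 0) (hm' : m'.re = 0) (hmn : m.imI * n₁ + m.imJ * n₂ + m.imK * n₃ = 0)
    (hm'n : m'.imI * n₁ + m'.imJ * n₂ + m'.imK * n₃ = 0) (hmm' : m.imI * m'.imI + m.imJ * m'.imJ + m.imK * m'.imK = 0) :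
    fixCoord (conjDir (quatMatrix m) (((fun _ => combFlat h'), fun _ => c') :
        (Fin (2 * L - 1 + 1) → GaugeConfig 3 L SU2) × (Site 3 L → SU2))) ⬝ᵥ
      fixCoord (conjDir (quatMatrix m') (((fun _ => combFlat h'), fun _ => c') :
        (Fin (2 * L - 1 + 1) → GaugeConfig 3 L SU2) × (Site 3 L → SU2))) = 0 := by
  rw [dotProduct, Fintype.sum_prod_type]
  refine Finset.sum_eq_zero fun v _ => ?_
  obtain ⟨t, ht⟩ := comb_varMat_axial (L := L) n₁ n₂ n₃ hh' hc' (fixVar v)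
  have h := sum_pauliCoord_conj_mul_conj ht hm hm'
  rw [hmm', hmn, hm'n, mul_zero, mul_zero, mul_zero, add_zero, mul_zero] at h
  refine Eq.trans (Finset.sum_congr rfl fun a _ => ?_) h
  rw [fixCoord_apply, fixCoord_apply, conjDir_quat, conjDir_quat]

/-- The Pauli norm of a conjugation slot at an axial UNIT quaternion: `Σ_a pc_a(q̄ m q − m)² = 16·t²·N·|m|²` (`m ⊥ n`). [folklore] -/
theorem sum_pauliCoord_conj_sq {q : ℍ} {t n₁ n₂ n₃ : ℝ} (hq : q.imI = t * n₁ ∧ q.imJ = t * n₂ ∧ q.imK = t * n₃)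
    (hq1 : q.re ^ 2 + q.imI ^ 2 + q.imJ ^ 2 + q.imK ^ 2 = 1)
    {m : ℍ} (hm : m.re = 0) (hmn : m.imI * n₁ + m.imJ * n₂ + m.imK * n₃ = 0) :
    ∑ a : Fin 3, pauliCoord (quatMatrix (star q * m * q - m)) a * pauliCoord (quatMatrix (star q * m * q - m)) a =
      16 * t ^ 2 * (n₁ ^ 2 + n₂ ^ 2 + n₃ ^ 2) * (m.imI ^ 2 + m.imJ ^ 2 + m.imK ^ 2) := by
  rw [sum_pauliCoord_conj_mul_conj hq hm hm, hmn, mul_zero, mul_zero, add_zero]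
  obtain ⟨hI, hJ, hK⟩ := hq
  rw [hI, hJ, hK] at hq1
  have hr : q.re ^ 2 = 1 - t ^ 2 * (n₁ ^ 2 + n₂ ^ 2 + n₃ ^ 2) := by linear_combination hq1
  rw [hr]
  ring

/-- ★ **A conjugation vector is non-zero at a NON-CENTRAL wrap block**: if the wrap datum `h' k` has `th k ≠ 0` (imaginary part `≠ 0`) then
`|fixCoord(conjDir (quatMatrix m) p)|² > 0` for pure imaginary `m ≠ 0`, `m ⊥ n`, `n ≠ 0`. [folklore] -/
theorem fixCoord_conj_dot_self_pos_of_wrap (n₁ n₂ n₃ : ℝ) (hn : 0 < n₁ ^ 2 + n₂ ^ 2 + n₃ ^ 2) {h' : Fin 3 → SU2} (c' : SU2)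
    {th : Fin 3 → ℝ}
    (hh' : ∀ j, (su2Quat (h' j)).imI = th j * n₁ ∧ (su2Quat (h' j)).imJ = th j * n₂ ∧ (su2Quat (h' j)).imK = th j * n₃)
    {m : ℍ} (hm : m.re = 0) (hmn : m.imI * n₁ + m.imJ * n₂ + m.imK * n₃ = 0) (hm0 : 0 < m.imI ^ 2 + m.imJ ^ 2 + m.imK ^ 2)
    {k : Fin 3} (hk : th k ≠ 0) :
    0 < fixCoord (conjDir (quatMatrix m) (((fun _ => combFlat h'), fun _ => c') :
        (Fin (2 * L - 1 + 1) → GaugeConfig 3 L SU2) × (Site 3 L → SU2))) ⬝ᵥ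
      fixCoord (conjDir (quatMatrix m) (((fun _ => combFlat h'), fun _ => c') :
        (Fin (2 * L - 1 + 1) → GaugeConfig 3 L SU2) × (Site 3 L → SU2))) := by
  have hwrap : ((fun _ : Fin 3 => (-1 : ZMod L)), k).1 k = -1 := rfl
  set v₀ : FixVar L := Sum.inl ⟨((fun _ : Fin 3 => (-1 : ZMod L)), k), not_treeEdge_of_wrap hwrap⟩ with hv₀
  set p : (Fin (2 * L - 1 + 1) → GaugeConfig 3 L SU2) × (Site 3 L → SU2) := ((fun _ => combFlat h'), fun _ => c') with hp
  have hvar : varMat p (fixVar v₀) = h' k := by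
    rw [hv₀, fixVar_off]
    simp only [varMat, Sum.elim_inl, hp, combFlat_apply]
    simp
  set f : FixVar L × Fin 3 → ℝ := fun va => fixCoord (conjDir (quatMatrix m) p) va * fixCoord (conjDir (quatMatrix m) p) va with hf
  have hq1 : (su2Quat (h' k)).re ^ 2 + (su2Quat (h' k)).imI ^ 2 + (su2Quat (h' k)).imJ ^ 2 + (su2Quat (h' k)).imK ^ 2 = 1 := by
    have h := normSq_su2Quat (h' k)
    rw [Quaternion.normSq_def'] at h
    exact h
  have hinner : ∑ a, f (v₀, a) = 16 * th k ^ 2 * (n₁ ^ 2 + n₂ ^ 2 + n₃ ^ 2) * (m.imI ^ 2 + m.imJ ^ 2 + m.imK ^ 2) := by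
    rw [← sum_pauliCoord_conj_sq (hh' k) hq1 hm hmn]
    refine Finset.sum_congr rfl fun a _ => ?_
    rw [hf]
    dsimp only
    rw [fixCoord_apply, conjDir_quat, hvar]
  have hpos : 0 < ∑ a, f (v₀, a) := by
    rw [hinner]
    have htk : 0 < th k ^ 2 := by positivity
    positivity
  calc (0 : ℝ) < ∑ a, f (v₀, a) := hpos
    _ ≤ ∑ va, f va := inner_le_sum_prod f (fun va => mul_self_nonneg _) v₀
    _ = _ := rfl

/-- ★ The same from a NON-CENTRAL seam datum (`tc ≠ 0`), at the seam site `0`. [folklore] -/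
theorem fixCoord_conj_dot_self_pos_of_seam (n₁ n₂ n₃ : ℝ) (hn : 0 < n₁ ^ 2 + n₂ ^ 2 + n₃ ^ 2) (h' : Fin 3 → SU2) {c' : SU2}
    {tc : ℝ} (hc' : (su2Quat c').imI = tc * n₁ ∧ (su2Quat c').imJ = tc * n₂ ∧ (su2Quat c').imK = tc * n₃)
    {m : ℍ} (hm : m.re = 0) (hmn : m.imI * n₁ + m.imJ * n₂ + m.imK * n₃ = 0) (hm0 : 0 < m.imI ^ 2 + m.imJ ^ 2 + m.imK ^ 2)
    (htc : tc ≠ 0) :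
    0 < fixCoord (conjDir (quatMatrix m) (((fun _ => combFlat h'), fun _ => c') :
        (Fin (2 * L - 1 + 1) → GaugeConfig 3 L SU2) × (Site 3 L → SU2))) ⬝ᵥ
      fixCoord (conjDir (quatMatrix m) (((fun _ => combFlat h'), fun _ => c') :
        (Fin (2 * L - 1 + 1) → GaugeConfig 3 L SU2) × (Site 3 L → SU2))) := by
  set v₀ : FixVar L := Sum.inr (Sum.inr fun _ => 0) with hv₀
  set p : (Fin (2 * L - 1 + 1) → GaugeConfig 3 L SU2) × (Site 3 L → SU2) := ((fun _ => combFlat h'), fun _ => c') with hp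
  have hvar : varMat p (fixVar v₀) = c' := by
    rw [hv₀, fixVar_seam]
    simp only [varMat, Sum.elim_inr, hp]
  set f : FixVar L × Fin 3 → ℝ := fun va => fixCoord (conjDir (quatMatrix m) p) va * fixCoord (conjDir (quatMatrix m) p) va with hf
  have hq1 : (su2Quat c').re ^ 2 + (su2Quat c').imI ^ 2 + (su2Quat c').imJ ^ 2 + (su2Quat c').imK ^ 2 = 1 := by
    have h := normSq_su2Quat c'
    rw [Quaternion.normSq_def'] at h
    exact h
  have hinner : ∑ a, f (v₀, a) = 16 * tc ^ 2 * (n₁ ^ 2 + n₂ ^ 2 + n₃ ^ 2) * (m.imI ^ 2 + m.imJ ^ 2 + m.imK ^ 2) := by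
    rw [← sum_pauliCoord_conj_sq hc' hq1 hm hmn]
    refine Finset.sum_congr rfl fun a _ => ?_
    rw [hf]
    dsimp only
    rw [fixCoord_apply, conjDir_quat, hvar]
  have hpos : 0 < ∑ a, f (v₀, a) := by
    rw [hinner]
    have htk : 0 < tc ^ 2 := by positivity
    positivity
  calc (0 : ℝ) < ∑ a, f (v₀, a) := hpos
    _ ≤ ∑ va, f va := inner_le_sum_prod f (fun va => mul_self_nonneg _) v₀
    _ = _ := rfl

end Summit.QuantumFields.YangMills.Theorems.VirialFluxGap.FixFrame

end
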